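import Mathlib
import Summits.AnomalousDissipation.AnomalousDissipation.Theses.TwoAndHalfD
import Summits.AnomalousDissipation.AnomalousDissipation.Theorems.TwoAndHalfDScalarLift2halfDRefutationTools
import Summits.AnomalousDissipation.AnomalousDissipation.Theorems.TwoAndHalfDScalarLiftRecord

/-!
# Route TwoAndHalfD (AnomalousDissipation) — refutation of the support item `ScalarLift2halfD`
  (stmt-AnomalousDissipation-14324) as stated: the datum `v₀` is unconstrained

The route declaration
`Summit.AnomalousDissipation.AnomalousDissipation.Theses.TwoAndHalfD.ScalarLift2halfD` quantifies
over an ARBITRARY planar datum `v₀ : 𝕋² → ℝ²`, tied to the planar Leray–Hopf solution `v` only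
through the hypothesis `Torus.IsGlobalLerayHopf ν (fun _ => g) v₀ v`. In the accepted structure
`Literature.Analysis.FluidPDE.Torus.IsLerayHopfOn` (`Literature/Analysis/FluidPDE/LerayHopf.lean`)
the datum enters only through Bochner integrals (`∫ ⟪u₀, ψ 0⟫` in the weak identity,
`kineticEnergy u₀ = ½ ∫ ‖u₀‖²` in `energy_ineq_zero`, `∫ ⟪u₀, w⟫` in `weak_continuous`), all
junk-valued (`0`) on non-a.e.-strongly-measurable integrands, and through the *lower* Lebesgue
integral `eLpNorm (u t - u₀) 2` in `strong_initial`, which vanishes for every function supported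
in a set of inner measure zero. Consequently (tools file
`TwoAndHalfDScalarLift2halfDRefutationTools`, `isLerayHopfOn_zero_of_innerNull`) the zero solution
`v ≡ 0` (force `g = 0`, `ν = 1`) is a global Leray–Hopf solution "with datum" `v₀ = 𝟙_C e₀` for
the non-null-measurable coordinate slab `C = {x : 𝕋² | x 0 ∈ A₀}` over a Vitali set
`A₀ ⊆ ℝ/ℤ`, although this `v₀` is not measurable. With `θ₀ = 1`, `h = 0` the CONCLUSION of the
item fails for every candidate `θ`: the lifted datum `twoHalf v₀ 1` has
`‖twoHalf v₀ 1‖² = 1 + 𝟙_{x 0 ∈ A₀}`, not a.e.-strongly measurable on `𝕋³`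
(`not_nullMeasurableSet_coordSlab`), so `kineticEnergy (twoHalf v₀ 1) = 0` (junk) and the energy
inequality from `0` of the asserted Leray–Hopf lift forces `twoHalf 0 (θ t) = 0` a.e. for every
`t ∈ [0, 1]`; the weak identity tested with the divergence-free field `ψ t x = η(t) e₃` (`η` a bump
with `η 0 = 1`) then reads `0 + ∫_{𝕋³} 1 = 0`. Hence `not_ScalarLift2halfD`.

CLASSIFICATION: misstated (missing side condition on the datum). Repaired statement C′ believed
true (the folklore 2½-dimensional lift; Bruè–De Lellis 2023, §3; Cheskidov 2023, §3, Lemma 3.2;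
Majda–Bertozzi 2002, §2.3.1), NOT proved here: add the hypothesis
`MeasureTheory.MemLp v₀ 2 MeasureTheory.volume` (given the Leray–Hopf hypothesis this is equivalent
to `AEStronglyMeasurable v₀ volume`, and then `v₀` is the genuine `L²` limit of `v t` at `0⁺` and
weakly divergence free); the witness misses C′ since `v₀ = 𝟙_C e₀` is not a.e.-strongly
measurable (`not_aestronglyMeasurable_indicator_coordSlab` of the tools file). The same
loophole affects crux #2 `ScalarAnomalySteadySourceFormal` and the glue `ScalarLiftGlue`, whose
`v₀ j` are likewise unconstrained.
-/

noncomputable section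

open MeasureTheory Set Filter Topology Function
open scoped ENNReal NNReal InnerProductSpace ContDiff

namespace Summit.AnomalousDissipation.AnomalousDissipation.Theorems

-- D-0017: single-problem summit ⇒ `Summit.AnomalousDissipation.AnomalousDissipation.…`.
set_option linter.dupNamespace false

open Literature.Analysis.FunctionSpaces Literature.Analysis.FunctionSpaces.Torus
open Literature.Analysis.FluidPDE Literature.Analysis.FluidPDE.Torus

/-! ### The refutation -/

section Main


/-- **Refutation of `ScalarLift2halfD` as stated** (stmt-AnomalousDissipation-14324, route
`TwoAndHalfD`; class: MISSTATED — missing side condition `MemLp v₀ 2 volume`). Witness: `ν = 1`,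
`g = 0`, `h = 0`, `v ≡ 0`, `θ₀ = 1`, and the non-measurable junk datum `v₀ = 𝟙_C e₀` with
`C = {x : 𝕋² | x 0 ∈ A₀}`, `A₀ ⊆ ℝ/ℤ` a Vitali set (inner measure zero, not null-measurable).
The hypotheses hold (`isLerayHopfOn_zero_of_innerNull`: the datum is invisible to lower
integrals and junk-valued in Bochner integrals). The conclusion fails for EVERY `θ`: from
`Torus.IsLerayHopfOn 1 1 0 (twoHalf v₀ 1) (fun t => twoHalf 0 (θ t))`, the energy inequality from
`0` with the junk value `kineticEnergy (twoHalf v₀ 1) = 0` (its integrand `1 + 𝟙_{x 0 ∈ A₀}` is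
not a.e.-strongly measurable on `𝕋³`, `not_nullMeasurableSet_coordSlab`) forces
`twoHalf 0 (θ t) = 0` a.e. for all `t ∈ [0, 1]`, and then the weak identity tested with the
divergence-free space–time field `ψ t x = η(t) e₃` (`η` a bump, `η 0 = 1`, `η = 0` on `[1/2, ∞)`)
reads `0 + ∫_{𝕋³} ⟪twoHalf v₀ 1, e₃⟫ = 0 + 1 = 0`. Repaired statement believed true (not proved
here): add the hypothesis `MeasureTheory.MemLp v₀ 2 MeasureTheory.volume` (Bruè–De Lellis 2023,
§3; Cheskidov 2023, §3, Lemma 3.2; Majda–Bertozzi 2002, §2.3.1); the witness misses it, `v₀`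
not being a.e.-strongly measurable. [folklore] -/
theorem not_ScalarLift2halfD :
    ¬ Summit.AnomalousDissipation.AnomalousDissipation.Theses.TwoAndHalfD.ScalarLift2halfD := by
  intro H
  -- the bad set and its coordinate slabs in `𝕋²` and `𝕋³`
  obtain ⟨A₀, hA₀nm, hA₀null⟩ := exists_innerNull_not_nullMeasurableSet_unitAddCircle
  set C₂ : Set (UnitAddTorus (Fin 2)) := {x | x 0 ∈ A₀} with hC₂_def
  set C₃ : Set (UnitAddTorus (Fin 3)) := {x | x 0 ∈ A₀} with hC₃_def
  have hC₂ : ∀ M : Set (UnitAddTorus (Fin 2)), MeasurableSet M → M ⊆ C₂ → volume M = 0 :=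
    innerNull_coordSlab (n := 1) hA₀null
  have hC₃ : ¬ NullMeasurableSet C₃ volume := not_nullMeasurableSet_coordSlab (n := 2) hA₀nm
  -- the data
  set e₀ : EuclideanSpace ℝ (Fin 2) := EuclideanSpace.single 0 1 with he₀
  set v₀ : UnitAddTorus (Fin 2) → EuclideanSpace ℝ (Fin 2) := C₂.indicator fun _ => e₀
    with hv₀_def
  set θ₀ : UnitAddTorus (Fin 2) → ℝ := fun _ => 1 with hθ₀_def
  have hLH : IsGlobalLerayHopf 1 (fun _ => (0 : UnitAddTorus (Fin 2) → EuclideanSpace ℝ (Fin 2)))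
      v₀ (fun _ => (0 : UnitAddTorus (Fin 2) → EuclideanSpace ℝ (Fin 2))) :=
    fun T _ => isLerayHopfOn_zero_of_innerNull hC₂ e₀ T
  have hdiv0 : IsDivFree (0 : UnitAddTorus (Fin 2) → EuclideanSpace ℝ (Fin 2)) := fun x => by
    simp [Literature.Analysis.FunctionSpaces.Torus.divergence,
      Literature.Analysis.FunctionSpaces.Torus.partialDeriv,
      Literature.Analysis.FunctionSpaces.Torus.lineDeriv]
  obtain ⟨θ, -, hL⟩ := H 1 0 0 v₀ (fun _ => 0) θ₀ one_pos
    (isSmooth_const (0 : EuclideanSpace ℝ (Fin 2))) hdiv0 (isSmooth_const (0 : ℝ)) (memLp_const 1) hLH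
  have h1 := hL 1 one_pos
  -- the junk energy of the lifted datum
  have hnm : ¬ AEStronglyMeasurable
      (fun x : UnitAddTorus (Fin 3) => ‖twoHalf v₀ θ₀ x‖ ^ 2) volume := by
    intro hm
    have hm' : AEStronglyMeasurable
        (fun x : UnitAddTorus (Fin 3) => ‖twoHalf v₀ θ₀ x‖ ^ 2 - 1) volume :=
      hm.sub aestronglyMeasurable_const
    have heq : (fun x : UnitAddTorus (Fin 3) => ‖twoHalf v₀ θ₀ x‖ ^ 2 - 1) =
        C₃.indicator (fun _ => (1 : ℝ)) := by
      funext x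
      rw [norm_sq_twoHalf]
      have hx0 : planarProj x 0 = x 0 := rfl
      by_cases hx : x ∈ C₃
      · have hx2 : planarProj x ∈ C₂ := by
          show planarProj x 0 ∈ A₀
          rw [hx0]; exact hx
        simp [hv₀_def, hθ₀_def, hx, hx2, he₀, PiLp.norm_single]
      · have hx2 : planarProj x ∉ C₂ := by
          show planarProj x 0 ∉ A₀
          rw [hx0]; exact hx
        simp [hv₀_def, hθ₀_def, hx, hx2]
    rw [heq] at hm'
    have hs := hm'.nullMeasurableSet_support
    rw [support_indicator, support_const one_ne_zero, inter_univ] at hs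
    exact hC₃ hs
  have hK0 : kineticEnergy (twoHalf v₀ θ₀) = 0 := by
    unfold kineticEnergy
    rw [integral_non_aestronglyMeasurable hnm, mul_zero]
  -- Step 1: the lift vanishes a.e. at every time in `[0, 1]`
  have hW : ∀ t ∈ Icc (0 : ℝ) 1,
      (fun x => twoHalf (0 : UnitAddTorus (Fin 2) → EuclideanSpace ℝ (Fin 2)) (θ t) x)
        =ᵐ[volume] 0 := by
    intro t ht
    have hE := h1.energy_ineq_zero t ht
    have hmem := h1.memLp t ht
    simp only [twoHalf_zero, Pi.zero_apply, inner_zero_left, integral_zero,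
      intervalIntegral.integral_zero, add_zero, hK0, one_mul] at hE hmem
    have hnn : 0 ≤ (∫⁻ τ in Ioo 0 t, eGradNormSq
        (twoHalf (0 : UnitAddTorus (Fin 2) → EuclideanSpace ℝ (Fin 2)) (θ τ))).toReal :=
      ENNReal.toReal_nonneg
    have hle : kineticEnergy
        (twoHalf (0 : UnitAddTorus (Fin 2) → EuclideanSpace ℝ (Fin 2)) (θ t)) ≤ 0 := by
      linarith
    have hKt : kineticEnergy
        (twoHalf (0 : UnitAddTorus (Fin 2) → EuclideanSpace ℝ (Fin 2)) (θ t)) = 0 :=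
      le_antisymm hle (kineticEnergy_nonneg _)
    have hint0 :
        ∫ x, ‖twoHalf (0 : UnitAddTorus (Fin 2) → EuclideanSpace ℝ (Fin 2)) (θ t) x‖ ^ 2 = 0 := by
      unfold kineticEnergy at hKt
      simpa using hKt
    have hae := (integral_eq_zero_iff_of_nonneg (fun x => sq_nonneg _)
      (hmem.integrable_norm_pow two_ne_zero)).1 hint0
    filter_upwards [hae] with x hx
    simpa using hx
  -- Step 2: the vertical test field `ψ t x = η t • e₃`
  let tb : ContDiffBump (0 : ℝ) := ⟨1 / 4, 1 / 2, by norm_num, by norm_num⟩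
  set η : ℝ → ℝ := fun t => tb t with hη
  have hη0 : η 0 = 1 := tb.one_of_mem_closedBall (by simp [tb])
  have hηT : ∀ t : ℝ, (1 / 2 : ℝ) ≤ t → η t = 0 := fun t ht =>
    tb.zero_of_le_dist (by
      rw [Real.dist_eq, sub_zero]
      exact ht.trans (le_abs_self t))
  set e₃ : EuclideanSpace ℝ (Fin 3) := EuclideanSpace.single 2 1 with he₃
  set ψ : ℝ → UnitAddTorus (Fin 3) → EuclideanSpace ℝ (Fin 3) := fun t _ => η t • e₃
    with hψ_def
  have hψ : IsSpaceTimeTest 1 ψ := by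
    refine ⟨?_, 1 / 2, by norm_num, fun t ht => ?_⟩
    · have hst : stLift ψ = fun p : ℝ × EuclideanSpace ℝ (Fin 3) => η p.1 • e₃ := rfl
      rw [hst]
      exact (tb.contDiff.comp contDiff_fst).smul contDiff_const
    · funext x
      show η t • e₃ = 0
      rw [hηT t ht, zero_smul]
  have hdiv : IsDivFreeTest ψ := fun t x => by
    simp [hψ_def, Literature.Analysis.FunctionSpaces.Torus.divergence,
      Literature.Analysis.FunctionSpaces.Torus.partialDeriv,
      Literature.Analysis.FunctionSpaces.Torus.lineDeriv]
  have hid := h1.weak.2.2.2 ψ hψ hdiv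
  -- the datum term equals `1`
  have hdatum : ∫ x, ⟪twoHalf v₀ θ₀ x, ψ 0 x⟫_ℝ = 1 := by
    have hpt : ∀ x : UnitAddTorus (Fin 3), ⟪twoHalf v₀ θ₀ x, ψ 0 x⟫_ℝ = 1 := fun x => by
      simp [hψ_def, hη0, he₃, EuclideanSpace.inner_single_right, hθ₀_def]
    simp_rw [hpt]
    simp
  -- the space–time term vanishes; contradiction
  have key : ∀ I : ℝ, I + ∫ x, ⟪twoHalf v₀ θ₀ x, ψ 0 x⟫_ℝ = 0 → I = 0 → False := by
    intro I h hI
    rw [hI, hdatum] at h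
    norm_num at h
  refine key _ hid ?_
  refine (setIntegral_congr_fun measurableSet_Ioo (g := fun _ => (0 : ℝ)) fun t ht => ?_).trans
    (by simp)
  refine (integral_congr_ae ?_).trans (integral_zero _ _)
  filter_upwards [hW t ⟨ht.1.le, ht.2.le⟩] with x hx
  simp only [Pi.zero_apply] at hx
  simp [hx, twoHalf_zero]

end Main

end Summit.AnomalousDissipation.AnomalousDissipation.Theorems
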